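import Summits.BirchSwinnertonDyer.BirchSwinnertonDyer.Theorems.SlopeDichotomyA2DegenerateLocusA2PrintPlacement
import Summits.BirchSwinnertonDyer.BirchSwinnertonDyer.Theorems.SlopeDichotomyA2DegenerateLocusA2TamagawaClass
import Summits.BirchSwinnertonDyer.BirchSwinnertonDyer.Theorems.Rank1ResidualX1Isogeny
import Literature.NumberTheory.EllipticCurves.ModularCurveManinSemistableBridgeProofs
import HarnessLib

/-!
# The degenerate locus of corner A2 is a union of `ℚ`-isogeny classes — «per class it is EMPTY or
# the WHOLE class» — and the crux `DegenerateLocusA2` (item stmt-BirchSwinnertonDyer-19086) and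
# Schneider's conjecture on A2 (K5's crux 6, item stmt-BirchSwinnertonDyer-19036) may be proved on
# any one member per class: WLOG `p ∣ ∏c_ℓ(E)`, or WLOG `E` carries an UNRAMIFIED-ODD rational `p`-line

Support file (prover seat `bsd-schneider-i1-c2`, gen 9, cell `bsd-schneider-ideate`; `--supports
stmt-BirchSwinnertonDyer-19086`). THEOREMS ONLY, conditional on named PUBLISHED facts (Perrin-Riou 1987
at odd `p`, Gross–Zagier–Kolyvagin, modularity, Cassels 1965, Cassels–Tate); nothing unconditional about
any curve, nothing booked. Companion of gens 0–8 (`…Concrete`, `…AnticyclotomicRoad`, `…Placement`,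
`…PrintPlacement`, `…CoLine`, `…TamagawaClass`, …); the item's verdict (DECIDED-REDUCED: 19086 ⟸ 19036,
19086 ⟺ 19035 modulo Keller–Yin Thm. 3.0.8 + PUB) is unchanged.

THE POINT (director D-0074 (K): «the degenerate locus … is empty/finite per class»). The hypothesis
of the crux, `DegenerateAt(W,p) :≡ ∃ Dh : PAdicHeightData W p, Dh.IsCanonical ∧ ¬ SchneiderConjecture Dh`
(THE canonical cyclotomic height is degenerate), is a property of the `ℚ`-ISOGENY CLASS of `W` at a pair
of corner A2 — so for each A2 class and prime the degenerate locus is either empty or the whole class,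
never a proper part of it. Mechanism (no `σ`-function functoriality needed): `ℚ`-isogenous curves have
the SAME newform `f` (Faltings, tree `IsNewformOf.of_isIsogenous`) and the same unit root `α`
(`a_p(E) = a_p(E')`, tree `X2.IsogenyLineTypeGoodOrdinary.unitRoot_eq_of_isIsogenous`), hence literally
the same Mazur–Swinnerton-Dyer series `L_p(f,α,T)`; and at an A2 pair a canonical datum violates
Schneider iff the LINEAR coefficient `[T¹]L_p(f,α,T)` vanishes (gen 3's
`DegenerateLocusA2PrintPlacement.not_schneider_iff_coeff_one_eq_zero` = Perrin-Riou 1987 §1.4 in rank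
one + GZK, the contrapositive of the certificate lemma
`Wuthrich2014.coeff_one_padicLFunction_ne_zero_iff_schneider_odd`). Corner A2 itself transports
(gen 7's `typeBRankOne_of_isIsogenous`) and THE canonical datum exists on every member
(`X1.PadicSigmaThree.exists_isCanonical_odd`, a tree theorem at odd good ordinary `p`).

* §1 `schneider_iff_of_isIsogenous`, `degenerate_iff_of_isIsogenous`, `forall_schneider_iff_of_isIsogenous`,
  `degenerate_class_dichotomy` — the pair-level class invariance and the «empty or full» dichotomy.
* §2 WLOG forms of the crux, BY NAME (`SlopeDichotomyA2.DegenerateLocusA2 ↔ …`): it suffices to prove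
  `BSD(E,p)` on the degenerate locus at the A2 pairs with `p ∣ ∏c_ℓ(E)`
  (`degenerateLocusA2_iff_of_dvd_tamagawaProduct`; every A2 class has such a member by gen 8's Tamagawa
  parity `DegenerateLocusA2TamagawaClass.exists_isIsogenous_dvd_tamagawaProduct_of_typeBRankOne`), or at
  the A2 pairs carrying an unramified-odd rational `p`-line
  (`degenerateLocusA2_iff_of_lineUnramifiedOdd`; gen 8's `exists_isIsogenous_lineUnramifiedOdd_of_gvPar`);
  `BSD(E,p)` comes back along the isogeny by Cassels (`Rank1ResidualX1Isogeny.bsdp_iff_of_isIsogenous`).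
* §3 The same two WLOG forms of K5's crux 6 `EisensteinPrimes.SchneiderOnX1TypeB` (item 19036, rider
  I1 on corner A2, no prover assigned): `schneiderOnX1TypeB_iff_of_dvd_tamagawaProduct`,
  `schneiderOnX1TypeB_iff_of_lineUnramifiedOdd`.

WHAT IS NOT CLAIMED. No instance of `BSD(E,p)` or of Schneider's conjecture is proved; the crux is
neither proved nor refuted (a non-vacuous instance would be a counterexample to `p`-adic BSD (i), none is
known: gens 0–8). Classically the invariance of degeneracy under isogeny is the functoriality
`⟨φP, φP⟩' = deg φ · ⟨P, P⟩` of the Mazur–Tate height; here it is read off the `p`-adic `L`-function,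
so it is CONDITIONAL on Perrin-Riou's rank-one formula (`hPR`) and GZK (`hGZK`).

References: [PerrinRiou1987] §1.4 Cor. 1.8; [Faltings1983Endlichkeit] §5 Korollar 2;
[MazurTateTeitelbaum1986Invent] §I.11, §I.14; [MilneADT2006] Thm. I.7.3; [GreenbergVatsal2000] Thm. (1.3),
§2 p. 28, §3 Cor. (3.8); [DokchitserDokchitser2015LocalInvariants] Thm. 8.2; [MazurSteinTate2006] Thm. 1.3.
-/

set_option autoImplicit false

noncomputable section

open scoped Classical AddSubgroup

open WeierstrassCurve Literature.NumberTheory.EllipticCurves Literature.NumberTheory.GaloisRepresentations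
  Literature.NumberTheory.EllipticCurves.ModularForms
  Field IsDedekindDomain NumberField
  Literature.NumberTheory.EllipticCurves.Rank1Residual
  Summit.BirchSwinnertonDyer.Rank1Residual
  Summit.BirchSwinnertonDyer.BirchSwinnertonDyer.Theses
  Summit.BirchSwinnertonDyer.BirchSwinnertonDyer.Theorems

-- `Summit.BirchSwinnertonDyer.BirchSwinnertonDyer.…`: the summit and its single sub-problem share a name (D-0017 layout).
set_option linter.dupNamespace false

namespace Summit.BirchSwinnertonDyer.BirchSwinnertonDyer.Theorems.DegenerateLocusA2IsogenyClass

variable {W W' : WeierstrassCurve ℚ} [W.IsElliptic] [W.IsGloballyMinimal] [W'.IsElliptic]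
  [W'.IsGloballyMinimal] {p : ℕ} [Fact p.Prime]

/-! ## §1. Degeneracy of THE canonical height is a `ℚ`-isogeny-class property on corner A2 -/

/-- **Schneider's conjecture at THE canonical datum is a `ℚ`-isogeny-class statement on corner A2.**
For globally minimal `W ∼ W'` with `(W, p)` on corner A2 (`X1.TypeBRankOne W p`) and canonical data
`Dh` on `W`, `Dh'` on `W'`: `SchneiderConjecture Dh ↔ SchneiderConjecture Dh'`, granted Perrin-Riou 1987
at odd `p` (`hPR`), GZK (`hGZK`) and modularity (`hmod`). Route: both sides are `[T¹]L_p(f,α,T) ≠ 0` for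
the COMMON newform `f` (`IsNewformOf.of_isIsogenous`) and the COMMON unit root
(`unitRoot_eq_of_isIsogenous`), by `DegenerateLocusA2PrintPlacement.not_schneider_iff_coeff_one_eq_zero`
on each side (`X1.TypeBRankOne W' p` by `typeBRankOne_of_isIsogenous`). Classically: functoriality of the
Mazur–Tate height under isogeny. [cite: PerrinRiou1987, §1.4 Cor. 1.8]
[cite: Faltings1983Endlichkeit, §5 Korollar 2] -/
theorem schneider_iff_of_isIsogenous (hPR : perrinRiou_rankOne_leadingTerms_odd)
    (hGZK : rank_eq_analyticRank_of_analyticRank_le_one) (hmod : exists_isNewformOf)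
    (hiso : IsIsogenous W W') (hB : X1.TypeBRankOne W p)
    {Dh : PAdicHeightData W p} (hDh : Dh.IsCanonical)
    {Dh' : PAdicHeightData W' p} (hDh' : Dh'.IsCanonical) :
    SchneiderConjecture Dh ↔ SchneiderConjecture Dh' := by
  have hB' : X1.TypeBRankOne W' p :=
    DegenerateLocusA2ValueSubgroupClass.typeBRankOne_of_isIsogenous hiso hB
  have hX := isClassX1_of_classX1 hB.1
  haveI : NeZero (W.conductorNorm ℤ) := ⟨(W.conductorNorm_pos_holds).ne'⟩
  obtain ⟨f, hf⟩ := hmod W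
  have hf' : IsNewformOf W' f := hf.of_isIsogenous hiso.symm_of_charZero
  have hα : unitRoot W' p = unitRoot W p :=
    (X2.IsogenyLineTypeGoodOrdinary.unitRoot_eq_of_isIsogenous hiso hX.hasGoodReductionAtPrime).symm
  have h1 := DegenerateLocusA2PrintPlacement.not_schneider_iff_coeff_one_eq_zero hPR hGZK W p hB Dh
    hDh f hf
  have h2 := DegenerateLocusA2PrintPlacement.not_schneider_iff_coeff_one_eq_zero hPR hGZK W' p hB' Dh'
    hDh' f hf'
  rw [hα] at h2
  rw [← not_iff_not, h1, h2]

/-- **Schneider on the class**: at an A2 pair, «every canonical datum of `W` satisfies Schneider» ↔ «every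
canonical datum of `W'` satisfies Schneider» for `W ∼ W'` globally minimal (THE canonical datum exists on
both sides at an odd good ordinary prime, `X1.PadicSigmaThree.exists_isCanonical_odd`).
[cite: PerrinRiou1987, §1.4 Cor. 1.8] [cite: MazurSteinTate2006, Thm. 1.3] -/
theorem forall_schneider_iff_of_isIsogenous (hPR : perrinRiou_rankOne_leadingTerms_odd)
    (hGZK : rank_eq_analyticRank_of_analyticRank_le_one) (hmod : exists_isNewformOf)
    (hiso : IsIsogenous W W') (hB : X1.TypeBRankOne W p) :
    (∀ Dh : PAdicHeightData W p, Dh.IsCanonical → SchneiderConjecture Dh) ↔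
      ∀ Dh' : PAdicHeightData W' p, Dh'.IsCanonical → SchneiderConjecture Dh' := by
  have hB' : X1.TypeBRankOne W' p :=
    DegenerateLocusA2ValueSubgroupClass.typeBRankOne_of_isIsogenous hiso hB
  have hX := isClassX1_of_classX1 hB.1
  have hX' := isClassX1_of_classX1 hB'.1
  constructor
  · intro h Dh' hDh'
    obtain ⟨Dh, hDh⟩ := X1.PadicSigmaThree.exists_isCanonical_odd W p hX.two_ne
      hX.hasGoodReductionAtPrime hX.not_dvd_frobeniusTrace
    exact (schneider_iff_of_isIsogenous hPR hGZK hmod hiso hB hDh hDh').mp (h Dh hDh)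
  · intro h Dh hDh
    obtain ⟨Dh', hDh'⟩ := X1.PadicSigmaThree.exists_isCanonical_odd W' p hX'.two_ne
      hX'.hasGoodReductionAtPrime hX'.not_dvd_frobeniusTrace
    exact (schneider_iff_of_isIsogenous hPR hGZK hmod hiso hB hDh hDh').mpr (h Dh' hDh')

/-- **The crux's hypothesis `DegenerateAt` is a `ℚ`-isogeny-class property on corner A2**: for globally
minimal `W ∼ W'` with `(W, p)` on corner A2, a canonical datum of `W` violates Schneider iff a canonical
datum of `W'` does — granted Perrin-Riou 1987 (`hPR`), GZK (`hGZK`), modularity (`hmod`). So inside A2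
the degenerate locus of route `SlopeDichotomyA2` is a union of `ℚ`-isogeny classes.
[cite: PerrinRiou1987, §1.4 Cor. 1.8] [cite: MazurSteinTate2006, Thm. 1.3] -/
theorem degenerate_iff_of_isIsogenous (hPR : perrinRiou_rankOne_leadingTerms_odd)
    (hGZK : rank_eq_analyticRank_of_analyticRank_le_one) (hmod : exists_isNewformOf)
    (hiso : IsIsogenous W W') (hB : X1.TypeBRankOne W p) :
    (∃ Dh : PAdicHeightData W p, Dh.IsCanonical ∧ ¬ SchneiderConjecture Dh) ↔
      ∃ Dh' : PAdicHeightData W' p, Dh'.IsCanonical ∧ ¬ SchneiderConjecture Dh' := by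
  have hB' : X1.TypeBRankOne W' p :=
    DegenerateLocusA2ValueSubgroupClass.typeBRankOne_of_isIsogenous hiso hB
  have hX := isClassX1_of_classX1 hB.1
  have hX' := isClassX1_of_classX1 hB'.1
  constructor
  · rintro ⟨Dh, hDh, hnot⟩
    obtain ⟨Dh', hDh'⟩ := X1.PadicSigmaThree.exists_isCanonical_odd W' p hX'.two_ne
      hX'.hasGoodReductionAtPrime hX'.not_dvd_frobeniusTrace
    exact ⟨Dh', hDh', fun h ↦ hnot ((schneider_iff_of_isIsogenous hPR hGZK hmod hiso hB hDh hDh').mpr h)⟩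
  · rintro ⟨Dh', hDh', hnot⟩
    obtain ⟨Dh, hDh⟩ := X1.PadicSigmaThree.exists_isCanonical_odd W p hX.two_ne
      hX.hasGoodReductionAtPrime hX.not_dvd_frobeniusTrace
    exact ⟨Dh, hDh, fun h ↦ hnot ((schneider_iff_of_isIsogenous hPR hGZK hmod hiso hB hDh hDh').mp h)⟩

/-- **«Per class the degenerate locus is EMPTY or the WHOLE class»** (the dichotomy behind the director's
wording of item 19086): at a pair `(W, p)` of corner A2, either EVERY globally minimal curve `ℚ`-isogenous
to `W` has a degenerate canonical datum at `p`, or NONE has — granted Perrin-Riou 1987 (`hPR`), GZK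
(`hGZK`), modularity (`hmod`). Excluded middle on `DegenerateAt(W,p)` + `degenerate_iff_of_isIsogenous`.
[cite: PerrinRiou1987, §1.4 Cor. 1.8] -/
theorem degenerate_class_dichotomy (hPR : perrinRiou_rankOne_leadingTerms_odd)
    (hGZK : rank_eq_analyticRank_of_analyticRank_le_one) (hmod : exists_isNewformOf)
    (hB : X1.TypeBRankOne W p) :
    (∀ (W' : WeierstrassCurve ℚ) [W'.IsElliptic] [W'.IsGloballyMinimal], IsIsogenous W W' →
        ∃ Dh' : PAdicHeightData W' p, Dh'.IsCanonical ∧ ¬ SchneiderConjecture Dh') ∨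
      ∀ (W' : WeierstrassCurve ℚ) [W'.IsElliptic] [W'.IsGloballyMinimal], IsIsogenous W W' →
        ¬ ∃ Dh' : PAdicHeightData W' p, Dh'.IsCanonical ∧ ¬ SchneiderConjecture Dh' := by
  by_cases hdeg : ∃ Dh : PAdicHeightData W p, Dh.IsCanonical ∧ ¬ SchneiderConjecture Dh
  · exact Or.inl fun W' _ _ hiso ↦ (degenerate_iff_of_isIsogenous hPR hGZK hmod hiso hB).mp hdeg
  · exact Or.inr fun W' _ _ hiso h ↦ hdeg ((degenerate_iff_of_isIsogenous hPR hGZK hmod hiso hB).mpr h)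

/-! ## §2. WLOG forms of the crux `DegenerateLocusA2` (item 19086), by name -/

/-- **WLOG `p ∣ ∏c_ℓ(E)`.** The crux `SlopeDichotomyA2.DegenerateLocusA2` is EQUIVALENT to its restriction
to the A2 pairs `(W, p)` with `p ∣ W.tamagawaProduct` — granted Perrin-Riou 1987 (`hPR`), GZK (`hGZK`),
modularity (`hmod`, `hmodE`), Cassels 1965 (`hCas`) and Cassels–Tate (`hCT`). (←): every A2 class has a
globally minimal member `W''` with `p ∣ ∏c_ℓ(W'')` (gen 8's Tamagawa parity along the Greenberg–Vatsal
isogeny, `DegenerateLocusA2TamagawaClass.exists_isIsogenous_dvd_tamagawaProduct_of_typeBRankOne`); corner A2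
and degeneracy transport to `W''` (§1), and `BSD(W'',p)` comes back by Cassels
(`Rank1ResidualX1Isogeny.bsdp_iff_of_isIsogenous`). [cite: DokchitserDokchitser2015LocalInvariants, Thm. 8.2]
[cite: MilneADT2006, Thm. I.7.3] [cite: PerrinRiou1987, §1.4 Cor. 1.8] -/
theorem degenerateLocusA2_iff_of_dvd_tamagawaProduct (hPR : perrinRiou_rankOne_leadingTerms_odd)
    (hGZK : rank_eq_analyticRank_of_analyticRank_le_one) (hmod : exists_isNewformOf)
    (hmodE : hasEntireLFunction_rat) (hCas : bsdRHS_eq_of_isIsogenous)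
    (hCT : exists_casselsTate_pairing (K := ℚ)) :
    SlopeDichotomyA2.DegenerateLocusA2 ↔
    ∀ (W : WeierstrassCurve ℚ) [W.IsElliptic] [W.IsGloballyMinimal] (p : ℕ) [Fact p.Prime],
      X1.TypeBRankOne W p → p ∣ W.tamagawaProduct →
      (∃ Dh : PAdicHeightData W p, Dh.IsCanonical ∧ ¬ SchneiderConjecture Dh) → BSDp W p := by
  constructor
  · intro h W _ _ p _ hB _ hdeg
    exact h W p hB hdeg
  · intro h W _ _ p _ hB hdeg
    obtain ⟨W'', hW'', hmin'', hiso, hTam⟩ :=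
      DegenerateLocusA2TamagawaClass.exists_isIsogenous_dvd_tamagawaProduct_of_typeBRankOne hCas hCT
        hGZK hB
    have hB'' : X1.TypeBRankOne W'' p :=
      DegenerateLocusA2ValueSubgroupClass.typeBRankOne_of_isIsogenous hiso hB
    have hdeg'' := (degenerate_iff_of_isIsogenous hPR hGZK hmod hiso hB).mp hdeg
    exact (Rank1ResidualX1Isogeny.bsdp_iff_of_isIsogenous hGZK hmodE hCas W W'' hiso p hB.2.1.le).mpr
      (h W'' p hB'' hTam hdeg'')

/-- **WLOG an UNRAMIFIED-ODD rational `p`-line.** The crux `SlopeDichotomyA2.DegenerateLocusA2` is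
EQUIVALENT to its restriction to the A2 pairs `(W, p)` at which `W` carries a rational `p`-line
`Φ ≤ E[p]` that is unramified at `p` and odd (one of the two Greenberg–Vatsal shapes; the other member of
the `p`-isogeny then carries the ramified-even line) — granted Perrin-Riou 1987 (`hPR`), GZK (`hGZK`),
modularity (`hmod`, `hmodE`) and Cassels 1965 (`hCas`). (←): gen 8's
`DegenerateLocusA2TamagawaClass.exists_isIsogenous_lineUnramifiedOdd_of_gvPar` supplies such a member in
every A2 class; §1 and Cassels do the transport. [cite: GreenbergVatsal2000, Thm. (1.3) and §2 p. 28]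
[cite: MilneADT2006, Thm. I.7.3] [cite: PerrinRiou1987, §1.4 Cor. 1.8] -/
theorem degenerateLocusA2_iff_of_lineUnramifiedOdd (hPR : perrinRiou_rankOne_leadingTerms_odd)
    (hGZK : rank_eq_analyticRank_of_analyticRank_le_one) (hmod : exists_isNewformOf)
    (hmodE : hasEntireLFunction_rat) (hCas : bsdRHS_eq_of_isIsogenous) :
    SlopeDichotomyA2.DegenerateLocusA2 ↔
    ∀ (W : WeierstrassCurve ℚ) [W.IsElliptic] [W.IsGloballyMinimal] (p : ℕ) [Fact p.Prime],
      X1.TypeBRankOne W p →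
      (∃ Φ : AddSubgroup (geomTorsion W (p : ℤ)),
        IsRationalLine W p Φ ∧ LineUnramifiedAt W p Φ ∧ LineOdd W p Φ) →
      (∃ Dh : PAdicHeightData W p, Dh.IsCanonical ∧ ¬ SchneiderConjecture Dh) → BSDp W p := by
  constructor
  · intro h W _ _ p _ hB _ hdeg
    exact h W p hB hdeg
  · intro h W _ _ p _ hB hdeg
    have hX := isClassX1_of_classX1 hB.1
    obtain ⟨W₀, hW₀, hmin₀, hiso, -, -, hΦ₀⟩ :=
      DegenerateLocusA2TamagawaClass.exists_isIsogenous_lineUnramifiedOdd_of_gvPar hX.two_ne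
        hX.hasGoodReductionAtPrime hX.not_dvd_frobeniusTrace hB.2.2
    have hB₀ : X1.TypeBRankOne W₀ p :=
      DegenerateLocusA2ValueSubgroupClass.typeBRankOne_of_isIsogenous hiso hB
    have hdeg₀ := (degenerate_iff_of_isIsogenous hPR hGZK hmod hiso hB).mp hdeg
    exact (Rank1ResidualX1Isogeny.bsdp_iff_of_isIsogenous hGZK hmodE hCas W W₀ hiso p hB.2.1.le).mpr
      (h W₀ p hB₀ hΦ₀ hdeg₀)

/-! ## §3. The same WLOG forms of K5's crux 6 `SchneiderOnX1TypeB` (item 19036) -/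

/-- **Schneider on corner A2, WLOG `p ∣ ∏c_ℓ(E)`**: K5's crux `EisensteinPrimes.SchneiderOnX1TypeB`
(Schneider's conjecture at every canonical datum of every A2 pair) is EQUIVALENT to its restriction to the
A2 pairs with `p ∣ W.tamagawaProduct` — granted Perrin-Riou 1987 (`hPR`), GZK (`hGZK`), modularity
(`hmod`), Cassels 1965 (`hCas`), Cassels–Tate (`hCT`). (←): gen 8's member with `p ∣ ∏c_ℓ`, corner A2
transported, THE canonical datum there (`exists_isCanonical_odd`), and `schneider_iff_of_isIsogenous`.
[cite: DokchitserDokchitser2015LocalInvariants, Thm. 8.2] [cite: PerrinRiou1987, §1.4 Cor. 1.8] -/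
theorem schneiderOnX1TypeB_iff_of_dvd_tamagawaProduct (hPR : perrinRiou_rankOne_leadingTerms_odd)
    (hGZK : rank_eq_analyticRank_of_analyticRank_le_one) (hmod : exists_isNewformOf)
    (hCas : bsdRHS_eq_of_isIsogenous) (hCT : exists_casselsTate_pairing (K := ℚ)) :
    EisensteinPrimes.SchneiderOnX1TypeB ↔
    ∀ (W : WeierstrassCurve ℚ) [W.IsElliptic] [W.IsGloballyMinimal] (p : ℕ) [Fact p.Prime],
      X1.TypeBRankOne W p → p ∣ W.tamagawaProduct →
      ∀ Dh : PAdicHeightData W p, Dh.IsCanonical → SchneiderConjecture Dh := by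
  constructor
  · intro h W _ _ p _ hB _ Dh hDh
    exact h W p hB Dh hDh
  · intro h W _ _ p _ hB Dh hDh
    obtain ⟨W'', hW'', hmin'', hiso, hTam⟩ :=
      DegenerateLocusA2TamagawaClass.exists_isIsogenous_dvd_tamagawaProduct_of_typeBRankOne hCas hCT
        hGZK hB
    have hB'' : X1.TypeBRankOne W'' p :=
      DegenerateLocusA2ValueSubgroupClass.typeBRankOne_of_isIsogenous hiso hB
    exact (forall_schneider_iff_of_isIsogenous hPR hGZK hmod hiso hB).mpr
      (fun Dh'' hDh'' ↦ h W'' p hB'' hTam Dh'' hDh'') Dh hDh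

/-- **Schneider on corner A2, WLOG an unramified-odd rational `p`-line**: K5's crux
`EisensteinPrimes.SchneiderOnX1TypeB` is EQUIVALENT to its restriction to the A2 pairs at which `W`
carries a rational `p`-line unramified at `p` and odd — granted Perrin-Riou 1987 (`hPR`), GZK (`hGZK`),
modularity (`hmod`). [cite: GreenbergVatsal2000, Thm. (1.3) and §2 p. 28]
[cite: PerrinRiou1987, §1.4 Cor. 1.8] -/
theorem schneiderOnX1TypeB_iff_of_lineUnramifiedOdd (hPR : perrinRiou_rankOne_leadingTerms_odd)
    (hGZK : rank_eq_analyticRank_of_analyticRank_le_one) (hmod : exists_isNewformOf) :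
    EisensteinPrimes.SchneiderOnX1TypeB ↔
    ∀ (W : WeierstrassCurve ℚ) [W.IsElliptic] [W.IsGloballyMinimal] (p : ℕ) [Fact p.Prime],
      X1.TypeBRankOne W p →
      (∃ Φ : AddSubgroup (geomTorsion W (p : ℤ)),
        IsRationalLine W p Φ ∧ LineUnramifiedAt W p Φ ∧ LineOdd W p Φ) →
      ∀ Dh : PAdicHeightData W p, Dh.IsCanonical → SchneiderConjecture Dh := by
  constructor
  · intro h W _ _ p _ hB _ Dh hDh
    exact h W p hB Dh hDh
  · intro h W _ _ p _ hB Dh hDh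
    have hX := isClassX1_of_classX1 hB.1
    obtain ⟨W₀, hW₀, hmin₀, hiso, -, -, hΦ₀⟩ :=
      DegenerateLocusA2TamagawaClass.exists_isIsogenous_lineUnramifiedOdd_of_gvPar hX.two_ne
        hX.hasGoodReductionAtPrime hX.not_dvd_frobeniusTrace hB.2.2
    have hB₀ : X1.TypeBRankOne W₀ p :=
      DegenerateLocusA2ValueSubgroupClass.typeBRankOne_of_isIsogenous hiso hB
    exact (forall_schneider_iff_of_isIsogenous hPR hGZK hmod hiso hB).mpr
      (fun Dh₀ hDh₀ ↦ h W₀ p hB₀ hΦ₀ Dh₀ hDh₀) Dh hDh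

end Summit.BirchSwinnertonDyer.BirchSwinnertonDyer.Theorems.DegenerateLocusA2IsogenyClass

end
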